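import Mathlib
import Literature.MathematicalPhysics.QuantumFieldTheory.Balaban1983to89.B6SectABlockSystem

/-!
# `Balaban1983to89.B6Eq217BlockSystem` — T. Bałaban, *Propagators and renormalization transformations for lattice
gauge theories. II*, Commun. Math. Phys. **96** (1984) 223–250 [Balaban1984PropagatorsII] (cell paper B6), Sect. A:
**(2.17) `R = I − G′Q′*(Q′G′²Q′*)⁻¹Q′G′`, (2.12), (2.13) and (2.26)–(2.27) `R = Δ𝒢Δ` PROVED for the concrete operators
of every block system** — file 2/2 of the model instance of Sect. A (file 1/2: `…B6SectABlockSystem`, the operators)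

statement-level skeleton of published theorems with citation tags; proofs where landed; nothing here is a claim about the
Yang–Mills mass gap.
PDF held: `paper:balaban1984-cmp96-propagators-rt-ii` (journal page = PDF page + 222); pp. 224–227 [PDF 2–5] read from the
×2 renders `run/shared/lean/pub/pub-balaban/b2b-balaban-ref1/pages/1984-cmp96-propagators-rt-II/…-p002,p003,p005-x2.png`.
WHAT IS REPRODUCED: cell `lit-balaban` (HOME `run/shared/lean/pub/lit-balaban/`), Phase-2 proof seat p21 gen 2 (unit
`lit-balaban-p21-g2`); SKELETON rows **`B6.Eq2.17`** (with `B6.Eq2.12`, `B6.Eq2.8`/`B6.Eq2.13` and `B6.Eq2.27` riding);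
owner r03 (`HOME/lit-balaban-r03/ROWS-B6.md` «Phase-2 targets … for the concrete lattice operators»), referee ref-4.
KIND: model instance — the abstract theorems of record are r03's `…B6SectA` (p238845) `starProjection_eq_repr217`,
`orbitMinimiser_unique`, `norm_sub_repr217_le`, `deltaPrime_calG_deltaPrime`, `conj_calG_eq_lap_calG_lap`, `comp_tildeOp_eq_zero`,
whose inverses `G′`, `(Q′G′²Q′*)⁻¹` and analytic input (2.11) are hypotheses there; here EVERY hypothesis is discharged
for the operators of file 1/2 on r03's `…B6Eq211.BlockSystem` (carrier of record of (2.11), p242700) under the printed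
facts (2.3)–(2.4) (`Cover`, `BlocksOffZero`); §3: met outright by r03's explicit 4 × 2 torus block system `fourByTwo`.
IMPORTED, not modified: `…B6SectABlockSystem` (hence `…B6SectA`, `…B6Eq211`).

WHAT THE PAPER PRINTS (pp. 225–227, verbatim).  (2.10)–(2.12) *"let R be an orthogonal projection in the space
L²(T_η) onto the subspace ΔN(Q′). Equation (2.9) implies Δλ₀ = R∂*A, and this equation has exactly one solution because
the Laplace operator Δ is positive on the subspace N(Q′) … Thus the functional (2.8) has exactly one minimum on each
orbit. This minimum satisfies the equation R∂*A^{λ₀} = 0, or R∂*A = 0 if we take A^{λ₀} as A. (2.12)"*; (2.13) *"a value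
Rf of the operator R acting on a function f defined on T_η is equal to Δλ, where λ is a minimum of the functional
λ ∈ N(Q′), λ → Σ_x η^d|f(x) − (Δλ)(x)|² = Σ_x η^d|f(x) − (Δ′_aλ)(x)|²"*; (2.17) *"Of course Q′λ = 0, hence Rf = Δλ = Δ′_aλ
= f − G′Q′*(Q′G′²Q′*)⁻¹Q′G′f."*; p. 227 *"𝒢 = G′² − G′²Q′*(Q′G′²Q′*)⁻¹Q′G′². (2.27) This formula, the equality (2.26)
[R = Δ𝒢Δ] and the equalities Q′𝒢 = 𝒢Q′* = 0 imply the representation (2.17)."*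

WHAT IS PROVED HERE (0 sorry, 0 named facts; `R` := Mathlib's orthogonal projection `(lapGauge S).starProjection`
onto `ΔN(Q′) = (ker Q′).map Δ`; `G′ = green`, `(Q′G′²Q′*)⁻¹ = cOp` from file 1/2):
§1 **(2.17)** `eq217`/`eq217_op`: `R = B6SectA.repr217 G′ Q′ Q′* (Q′G′²Q′*)⁻¹`; **(2.8)/(2.13)** `isMin_iff`, `eq213`:
   `λ ∈ N(Q′)` minimises `μ ↦ ‖f − Δμ‖` over N(Q′) iff `Rf = Δλ`, and `‖f − Rf‖ ≤ ‖f − Δ′_aλ‖ = ‖f − Δλ‖`;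
   **(2.12)** `eq212`, `eq212_gauge`, `eq212_solution`: for every `f` (in print `f = ∂*A`) EXACTLY ONE minimiser
   `λ₀ ∈ N(Q′)`, it satisfies `R(f − Δλ₀) = 0` (= `R∂*A^{λ₀} = 0`), and `Δλ₀ = Rf` has exactly one solution in N(Q′);
   **(2.26)–(2.27)** `eq227`, `eq226`, `calG_annihilate`: `R = Δ𝒢Δ` with `𝒢 = B6SectA.calG G′ Q′ Q′* (Q′G′²Q′*)⁻¹`,
   `Q′𝒢 = 𝒢Q′* = 0`.
§2 DICTIONARY: with the PRINTED weighted adjoint `Q′*_{pr} = Q′* ∘ vol` ((2.15): weights (L^jη)^d vs η^d; `QpsPr`,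
   `pairing215`) and ITS inverse `vol⁻¹ ∘ (Q′G′²Q′*)⁻¹` the operator (2.17) is THE SAME (`repr217_printedAdjoint`,
   `eq217_printed`).  §3 `eq217_fourByTwo`: (2.17) on the 4 × 2 torus with two blocks (k = 1, Λ₀ = ∅), no hypothesis left.
NOT HERE: the vector-field side (2.18)–(2.23), (2.31)–(2.35) (no plaquettes in `BlockSystem`); any bound.
-/

namespace Literature.MathematicalPhysics.QuantumFieldTheory.Balaban1983to89.B6Eq217BlockSystem

open Finset B6SectABlockSystem
open scoped BigOperators InnerProductSpace
open B6Eq211 (BlockSystem)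

noncomputable section

variable {ι κ β : Type*}

/-! ## §0. `Q′` onto, `Q′*` injective, `Q′G′²Q′* > 0`, `(Q′G′²Q′*)⁻¹` constructed; the volume weights -/

section Cinv

variable (S : BlockSystem ι κ β)

/-- **`Q′` is onto** when the blocks lie off `Λ₀`: prescribe `λ` on `Λ₀` and block-constant on each block.
[cite: Balaban1984PropagatorsII, (2.3)–(2.4) p.224, (2.14) p.225] -/
theorem Qp_surjective (hdisj : BlocksOffZero S) : Function.Surjective (Qp S) := by
  classical
  intro ω
  let lam : ι → ℝ := fun x =>
    if hx : x ∈ S.zeroSet then ω (Sum.inl ⟨x, hx⟩)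
    else if hb : ∃ b, ∃ y, S.chart b y = x then ω (Sum.inr hb.choose) else 0
  refine ⟨WithLp.toLp 2 lam, PiLp.ext fun i => ?_⟩
  cases i with
  | inl x => rw [Qp_apply_inl]; show lam x = ω (Sum.inl x); simp only [lam, dif_pos x.2]
  | inr b =>
    have hval : ∀ y, lam (S.chart b y) = ω (Sum.inr b) := by
      intro y
      have hb : ∃ b', ∃ y', S.chart b' y' = S.chart b y := ⟨b, y, rfl⟩
      have hbb : hb.choose = b := by
        by_contra hne
        obtain ⟨y', hy'⟩ := hb.choose_spec
        exact S.chart_disjoint _ _ hne y' y hy'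
      simp only [lam, dif_neg (hdisj b y), dif_pos hb, hbb]
    have hsum : ∑ y, (WithLp.toLp 2 lam : EuclideanSpace ℝ ι) (S.chart b y) =
        ∑ _y : Fin S.d → Fin (S.side b + 1), ω (Sum.inr b) := Finset.sum_congr rfl fun y _ => hval y
    rw [Qp_apply_inr, hsum, Finset.sum_const, Finset.card_univ, nsmul_eq_mul, card_cube, ← mul_assoc,
      inv_mul_cancel₀ (vol_pos S b).ne', one_mul]

/-- The relative volume operator on `L²(𝔅)`: multiplication by `(L^jη)^d/η^d = (L^j)^d` on `B^j(y)`, by `1` on `Λ₀` —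
the ratio of the printed weights of (2.15) to those of (2.13). [cite: Balaban1984PropagatorsII, (2.15) p.225] -/
abbrev volOp : EuclideanSpace ℝ (AvgIdx S) →ₗ[ℝ] EuclideanSpace ℝ (AvgIdx S) :=
  aOp S (Sum.elim (fun _ => 1) (fun b => vol S b))

/-- Its inverse, multiplication by `(L^j)^{−d}`. [cite: Balaban1984PropagatorsII, (2.15) p.225] -/
abbrev volInv : EuclideanSpace ℝ (AvgIdx S) →ₗ[ℝ] EuclideanSpace ℝ (AvgIdx S) :=
  aOp S (Sum.elim (fun _ => 1) (fun b => (vol S b)⁻¹))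

/-- `vol ∘ vol⁻¹ = id`. [cite: Balaban1984PropagatorsII, (2.15) p.225] -/
theorem volOp_comp_volInv : volOp S ∘ₗ volInv S = LinearMap.id := by
  refine LinearMap.ext fun φ => PiLp.ext fun i => ?_
  cases i with
  | inl x => simp only [LinearMap.comp_apply, LinearMap.id_apply, aOp_apply, Sum.elim_inl, one_mul]
  | inr b =>
    simp only [LinearMap.comp_apply, LinearMap.id_apply, aOp_apply, Sum.elim_inr]
    rw [mul_inv_cancel_left₀ (vol_pos S b).ne']

variable [Fintype ι] [Fintype β] [DecidablePred (· ∈ S.zeroSet)]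

/-- **`Q′*` is injective** (adjoint of an onto map) — the printed step *"Q′*ω = 0, hence ω = 0"* of [4] p. 25 for the
multi-scale `Q′`. [cite: Balaban1984PropagatorsII, p.225 after (2.17)] -/
theorem Qps_injective (hdisj : BlocksOffZero S) : Function.Injective (Qps S) := by
  intro ω ω' hω
  have hsub : Qps S (ω - ω') = 0 := by rw [map_sub, hω, sub_self]
  obtain ⟨f, hf⟩ := Qp_surjective S hdisj (ω - ω')
  have h0 : ⟪ω - ω', ω - ω'⟫_ℝ = 0 := by
    calc ⟪ω - ω', ω - ω'⟫_ℝ = ⟪ω - ω', Qp S f⟫_ℝ := by rw [hf]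
      _ = ⟪Qps S (ω - ω'), f⟫_ℝ := (inner_Qps_left S _ _).symm
      _ = 0 := by rw [hsub, inner_zero_left]
  exact sub_eq_zero.mp (inner_self_eq_zero.mp h0)

variable [Fintype κ] [DecidableEq κ]

/-- **`Q′G′²Q′*`** on `L²(𝔅)`. [cite: Balaban1984PropagatorsII, (2.17) p.225] -/
def qggq {w : AvgIdx S → ℝ} (hw : ∀ i, 0 < w i) (hcover : Cover S) :
    EuclideanSpace ℝ (AvgIdx S) →ₗ[ℝ] EuclideanSpace ℝ (AvgIdx S) :=
  Qp S ∘ₗ (green S hw hcover ∘ₗ green S hw hcover) ∘ₗ Qps S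

/-- *"⟨ω, Q′G′²Q′*ω⟩ = ‖G′Q′*ω‖²"* (the printed positivity computation of [4] p. 25, multi-scale version).
[cite: Balaban1984PropagatorsII, p.225 after (2.17)] -/
theorem inner_qggq_self {w : AvgIdx S → ℝ} (hw : ∀ i, 0 < w i) (hcover : Cover S)
    (ω : EuclideanSpace ℝ (AvgIdx S)) : ⟪ω, qggq S hw hcover ω⟫_ℝ = ‖green S hw hcover (Qps S ω)‖ ^ 2 := by
  rw [qggq, LinearMap.comp_apply, LinearMap.comp_apply, LinearMap.comp_apply, ← real_inner_self_eq_norm_sq,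
    ← inner_Qps_left, green_symm]

/-- **`Q′G′²Q′*` is positive definite** (*"This implies that G′² and Q′G′²Q′* are positive operators, hence
(Q′G′²Q′*)⁻¹ is well defined"*): `⟨ω, Q′G′²Q′*ω⟩ = 0` forces `ω = 0`. [cite: Balaban1984PropagatorsII, p.225 after (2.17)] -/
theorem eq_zero_of_inner_qggq_self_eq_zero {w : AvgIdx S → ℝ} (hw : ∀ i, 0 < w i) (hcover : Cover S)
    (hdisj : BlocksOffZero S) (ω : EuclideanSpace ℝ (AvgIdx S)) (h0 : ⟪ω, qggq S hw hcover ω⟫_ℝ = 0) : ω = 0 := by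
  rw [inner_qggq_self] at h0
  have h1 : green S hw hcover (Qps S ω) = 0 := norm_eq_zero.mp ((pow_eq_zero_iff two_ne_zero).mp h0)
  have h2 : Qps S ω = 0 := by rw [← deltaP_green S hw hcover (Qps S ω), h1, map_zero]
  exact Qps_injective S hdisj (by rw [h2, map_zero])

/-- `Q′G′²Q′*` is injective. [cite: Balaban1984PropagatorsII, p.225 after (2.17)] -/
theorem qggq_injective {w : AvgIdx S → ℝ} (hw : ∀ i, 0 < w i) (hcover : Cover S) (hdisj : BlocksOffZero S) :
    Function.Injective (qggq S hw hcover) := by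
  intro ω ω' h
  have h0 : qggq S hw hcover (ω - ω') = 0 := by rw [map_sub, h, sub_self]
  exact sub_eq_zero.mp
    (eq_zero_of_inner_qggq_self_eq_zero S hw hcover hdisj (ω - ω') (by rw [h0, inner_zero_right]))

/-- **`(Q′G′²Q′*)⁻¹`** (*"hence (Q′G′²Q′*)⁻¹ is well defined and positive also"*), CONSTRUCTED as the inverse of the
injective endomorphism `Q′G′²Q′*` of the finite-dimensional `L²(𝔅)`. [cite: Balaban1984PropagatorsII, (2.17) p.225] -/
def cOp {w : AvgIdx S → ℝ} (hw : ∀ i, 0 < w i) (hcover : Cover S) (hdisj : BlocksOffZero S) :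
    EuclideanSpace ℝ (AvgIdx S) →ₗ[ℝ] EuclideanSpace ℝ (AvgIdx S) :=
  (LinearEquiv.ofInjectiveEndo (qggq S hw hcover) (qggq_injective S hw hcover hdisj)).symm.toLinearMap

/-- `(Q′G′²Q′*)(Q′G′²Q′*)⁻¹ = I`. [cite: Balaban1984PropagatorsII, (2.17) p.225] -/
theorem qggq_cOp {w : AvgIdx S → ℝ} (hw : ∀ i, 0 < w i) (hcover : Cover S) (hdisj : BlocksOffZero S)
    (φ : EuclideanSpace ℝ (AvgIdx S)) : qggq S hw hcover (cOp S hw hcover hdisj φ) = φ :=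
  (LinearEquiv.ofInjectiveEndo _ (qggq_injective S hw hcover hdisj)).apply_symm_apply φ

/-- `(Q′G′²Q′*)⁻¹(Q′G′²Q′*) = I`. [cite: Balaban1984PropagatorsII, (2.17) p.225] -/
theorem cOp_qggq {w : AvgIdx S → ℝ} (hw : ∀ i, 0 < w i) (hcover : Cover S) (hdisj : BlocksOffZero S)
    (φ : EuclideanSpace ℝ (AvgIdx S)) : cOp S hw hcover hdisj (qggq S hw hcover φ) = φ :=
  (LinearEquiv.ofInjectiveEndo _ (qggq_injective S hw hcover hdisj)).symm_apply_apply φ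

/-- `(Q′G′²Q′*) ∘ (Q′G′²Q′*)⁻¹ = id` (hypothesis `hE1` of `B6SectA`). [cite: Balaban1984PropagatorsII, (2.17) p.225] -/
theorem qggq_comp_cOp {w : AvgIdx S → ℝ} (hw : ∀ i, 0 < w i) (hcover : Cover S) (hdisj : BlocksOffZero S) :
    (Qp S ∘ₗ (green S hw hcover ∘ₗ green S hw hcover) ∘ₗ Qps S) ∘ₗ cOp S hw hcover hdisj = LinearMap.id :=
  LinearMap.ext (qggq_cOp S hw hcover hdisj)

/-- `(Q′G′²Q′*)⁻¹ ∘ (Q′G′²Q′*) = id` (hypothesis `hE2` of `B6SectA`). [cite: Balaban1984PropagatorsII, (2.27) p.227] -/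
theorem cOp_comp_qggq {w : AvgIdx S → ℝ} (hw : ∀ i, 0 < w i) (hcover : Cover S) (hdisj : BlocksOffZero S) :
    cOp S hw hcover hdisj ∘ₗ (Qp S ∘ₗ (green S hw hcover ∘ₗ green S hw hcover) ∘ₗ Qps S) = LinearMap.id :=
  LinearMap.ext (cOp_qggq S hw hcover hdisj)

end Cinv

/-! ## §1. (2.17), (2.8)/(2.13), (2.12) and (2.26)–(2.27) on every block system -/

section Main

variable (S : BlockSystem ι κ β) [Fintype ι] [Fintype κ]

/-- **`ΔN(Q′)`**, the target space of `R` (*"the subspace ΔN(Q′)"* of `L²(T_η)`). [cite: Balaban1984PropagatorsII, (2.10) p.225] -/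
abbrev lapGauge : Submodule ℝ (EuclideanSpace ℝ ι) := (B6SectA.gaugeSpace (Qp S)).map (lap S)

/-- `v ∈ ΔN(Q′)` iff `v = Δλ` for some `λ` with `Q′λ = 0`. [cite: Balaban1984PropagatorsII, (2.10) p.225] -/
theorem mem_lapGauge_iff (v : EuclideanSpace ℝ ι) :
    v ∈ lapGauge S ↔ ∃ lam : EuclideanSpace ℝ ι, Qp S lam = 0 ∧ lap S lam = v := by
  simp only [lapGauge, Submodule.mem_map, B6SectA.gaugeSpace, LinearMap.mem_ker]

/-- The distance from `f` to `ΔN(Q′)` is attained at `Rf`: `‖f − Rf‖ ≤ ‖f − v‖` for `v ∈ ΔN(Q′)` (Pythagoras).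
[cite: Balaban1984PropagatorsII, (2.13) p.225] -/
theorem norm_sub_proj_le (f v : EuclideanSpace ℝ ι) (hv : v ∈ lapGauge S) :
    ‖f - (lapGauge S).starProjection f‖ ≤ ‖f - v‖ := by
  set p := (lapGauge S).starProjection f with hp
  have horth : ⟪f - p, p - v⟫_ℝ = 0 :=
    Submodule.starProjection_inner_eq_zero f _ (Submodule.sub_mem _ (Submodule.starProjection_apply_mem _ f) hv)
  have hdecomp : f - v = (f - p) + (p - v) := by abel
  have hpy : ‖f - v‖ * ‖f - v‖ = ‖f - p‖ * ‖f - p‖ + ‖p - v‖ * ‖p - v‖ := by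
    rw [hdecomp]; exact norm_add_sq_eq_norm_sq_add_norm_sq_of_inner_eq_zero _ _ horth
  nlinarith [norm_nonneg (f - v), norm_nonneg (f - p), norm_nonneg (p - v)]

/-- **(2.8)/(2.13), the variational characterisation of `R`:** for `λ ∈ N(Q′)`, `λ` minimises `μ ↦ ‖f − Δμ‖` over
`N(Q′)` (the functional (2.8) with `f = ∂*A`, resp. (2.13)) IFF `Rf = Δλ` (*"a value Rf of the operator R acting on a
function f … is equal to Δλ, where λ is a minimum of the functional (2.13)"*). [cite: Balaban1984PropagatorsII, (2.8) p.224, (2.13) p.225] -/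
theorem isMin_iff (f lam : EuclideanSpace ℝ ι) (hlam : Qp S lam = 0) :
    (∀ mu : EuclideanSpace ℝ ι, Qp S mu = 0 → ‖f - lap S lam‖ ≤ ‖f - lap S mu‖) ↔
      (lapGauge S).starProjection f = lap S lam := by
  have hmem : lap S lam ∈ lapGauge S := (mem_lapGauge_iff S _).2 ⟨lam, hlam, rfl⟩
  constructor
  · intro hmin
    set p := (lapGauge S).starProjection f with hp
    have hpmem : p ∈ lapGauge S := Submodule.starProjection_apply_mem _ f
    obtain ⟨mu, hmu, hmu'⟩ := (mem_lapGauge_iff S p).1 hpmem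
    have hle : ‖f - lap S lam‖ ≤ ‖f - p‖ := by rw [← hmu']; exact hmin mu hmu
    have horth : ⟪f - p, p - lap S lam⟫_ℝ = 0 :=
      Submodule.starProjection_inner_eq_zero f _ (Submodule.sub_mem _ hpmem hmem)
    have hdecomp : f - lap S lam = (f - p) + (p - lap S lam) := by abel
    have hpy : ‖f - lap S lam‖ * ‖f - lap S lam‖ = ‖f - p‖ * ‖f - p‖ + ‖p - lap S lam‖ * ‖p - lap S lam‖ := by
      rw [hdecomp]; exact norm_add_sq_eq_norm_sq_add_norm_sq_of_inner_eq_zero _ _ horth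
    have hc : ‖p - lap S lam‖ * ‖p - lap S lam‖ ≤ 0 := by nlinarith [norm_nonneg (f - lap S lam), norm_nonneg (f - p)]
    have hc0 : ‖p - lap S lam‖ = 0 := by nlinarith [mul_self_nonneg ‖p - lap S lam‖, norm_nonneg (p - lap S lam)]
    exact sub_eq_zero.mp (norm_eq_zero.mp hc0)
  · intro hR mu hmu
    rw [← hR]
    exact norm_sub_proj_le S f _ ((mem_lapGauge_iff S _).2 ⟨mu, hmu, rfl⟩)

/-- **(2.12), the gauge condition:** the minimiser `λ₀` satisfies `R(f − Δλ₀) = 0`, i.e. *"R∂*A^{λ₀} = 0"* for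
`f = ∂*A` (`∂*A^{λ₀} = ∂*A − Δλ₀`, Δ = ∂*∂ on functions). [cite: Balaban1984PropagatorsII, (2.12) p.225] -/
theorem eq212_gauge (f lam0 : EuclideanSpace ℝ ι) (h0 : Qp S lam0 = 0)
    (hmin : ∀ mu : EuclideanSpace ℝ ι, Qp S mu = 0 → ‖f - lap S lam0‖ ≤ ‖f - lap S mu‖) :
    (lapGauge S).starProjection (f - lap S lam0) = 0 := by
  have hR := (isMin_iff S f lam0 h0).1 hmin
  rw [map_sub, hR, Submodule.starProjection_eq_self_iff.2 ((mem_lapGauge_iff S _).2 ⟨lam0, h0, rfl⟩), sub_self]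

variable [Fintype β] [DecidableEq κ]

/-- **(2.12) PROVED on every covering block system:** *"Thus the functional (2.8) has exactly one minimum on each
orbit"* — for every `f ∈ L²(T_η)` (in print `f = ∂*A`) there is EXACTLY ONE `λ₀ ∈ N(Q′)` minimising `λ ↦ ‖f − Δλ‖` over
`N(Q′)` (uniqueness: `B6SectA.orbitMinimiser_unique` with `hinj` = `lap_injOn_gauge`, i.e. (2.11)). [cite: Balaban1984PropagatorsII, (2.12) p.225] -/
theorem eq212 (hcover : Cover S) (f : EuclideanSpace ℝ ι) :
    ∃! lam0 : EuclideanSpace ℝ ι, Qp S lam0 = 0 ∧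
      ∀ mu : EuclideanSpace ℝ ι, Qp S mu = 0 → ‖f - lap S lam0‖ ≤ ‖f - lap S mu‖ := by
  obtain ⟨lam0, h0, hlap⟩ := (mem_lapGauge_iff S _).1 (Submodule.starProjection_apply_mem (lapGauge S) f)
  refine ⟨lam0, ⟨h0, (isMin_iff S f lam0 h0).2 hlap.symm⟩, ?_⟩
  rintro lam1 ⟨h1, hmin1⟩
  have hR1 := (isMin_iff S f lam1 h1).1 hmin1
  exact B6SectA.orbitMinimiser_unique (lap S) (Qp S) (lap_injOn_gauge S hcover)
    ((mem_gaugeSpace_iff_eq S lam1).2 h1) ((mem_gaugeSpace_iff_eq S lam0).2 h0) (by rw [← hR1, hlap])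

/-- *"Equation (2.9) implies Δλ₀ = R∂*A, and this equation has exactly one solution"*: there is exactly one
`λ₀ ∈ N(Q′)` with `Δλ₀ = Rf`. [cite: Balaban1984PropagatorsII, (2.12) p.225] -/
theorem eq212_solution (hcover : Cover S) (f : EuclideanSpace ℝ ι) :
    ∃! lam0 : EuclideanSpace ℝ ι, Qp S lam0 = 0 ∧ lap S lam0 = (lapGauge S).starProjection f := by
  obtain ⟨lam0, h0, hlap⟩ := (mem_lapGauge_iff S _).1 (Submodule.starProjection_apply_mem (lapGauge S) f)
  refine ⟨lam0, ⟨h0, hlap⟩, ?_⟩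
  rintro lam1 ⟨h1, hlap1⟩
  exact B6SectA.orbitMinimiser_unique (lap S) (Qp S) (lap_injOn_gauge S hcover)
    ((mem_gaugeSpace_iff_eq S lam1).2 h1) ((mem_gaugeSpace_iff_eq S lam0).2 h0) (by rw [hlap1, hlap])

variable [DecidablePred (· ∈ S.zeroSet)]

/-- **(2.17) PROVED on every block system:** *"let R be an orthogonal projection in the space L²(T_η) onto the
subspace ΔN(Q′) … Rf = Δλ = Δ′_aλ = f − G′Q′*(Q′G′²Q′*)⁻¹Q′G′f. (2.17)"* — the orthogonal projection onto `ΔN(Q′)`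
EQUALS `B6SectA.repr217 G′ Q′ Q′* (Q′G′²Q′*)⁻¹` for the constructed operators (every hypothesis of
`B6SectA.starProjection_eq_repr217` discharged). [cite: Balaban1984PropagatorsII, (2.17) p.225] -/
theorem eq217 {w : AvgIdx S → ℝ} (hw : ∀ i, 0 < w i) (hcover : Cover S) (hdisj : BlocksOffZero S)
    (f : EuclideanSpace ℝ ι) :
    (lapGauge S).starProjection f = B6SectA.repr217 (green S hw hcover) (Qp S) (Qps S) (cOp S hw hcover hdisj) f :=
  B6SectA.starProjection_eq_repr217 (deltaP S w) (green S hw hcover) (Qp S) (Qps S) (cOp S hw hcover hdisj)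
    (green_symm S hw hcover) (fun ω v => inner_Qps_left S ω v) (deltaP_comp_green S hw hcover)
    (green_comp_deltaP S hw hcover) (qggq_comp_cOp S hw hcover hdisj) (lapGauge S)
    (B6SectA.map_deltaPrime_ker_eq (lap S) (Qp S) (Qps S) (aOp S w)).symm f

/-- (2.17) as an identity of operators on `L²(T_η)`. [cite: Balaban1984PropagatorsII, (2.17) p.225] -/
theorem eq217_op {w : AvgIdx S → ℝ} (hw : ∀ i, 0 < w i) (hcover : Cover S) (hdisj : BlocksOffZero S) :
    ((lapGauge S).starProjection : EuclideanSpace ℝ ι →ₗ[ℝ] EuclideanSpace ℝ ι) =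
      B6SectA.repr217 (green S hw hcover) (Qp S) (Qps S) (cOp S hw hcover hdisj) :=
  LinearMap.ext fun f => eq217 S hw hcover hdisj f

/-- **(2.13) for the constructed operators:** `‖f − Rf‖ ≤ ‖f − Δ′_aλ‖` for every `λ ∈ N(Q′)` (`R` in the form (2.17))
and `Δ′_aλ = Δλ` there (`B6SectA.norm_sub_repr217_le`/`deltaPrime_apply_of_mem_ker` discharged). [cite: Balaban1984PropagatorsII, (2.13) p.225] -/
theorem eq213 {w : AvgIdx S → ℝ} (hw : ∀ i, 0 < w i) (hcover : Cover S) (hdisj : BlocksOffZero S)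
    (f n : EuclideanSpace ℝ ι) (hn : Qp S n = 0) :
    ‖f - B6SectA.repr217 (green S hw hcover) (Qp S) (Qps S) (cOp S hw hcover hdisj) f‖ ≤ ‖f - deltaP S w n‖ ∧
      deltaP S w n = lap S n :=
  ⟨B6SectA.norm_sub_repr217_le (deltaP S w) (green S hw hcover) (Qp S) (Qps S) (cOp S hw hcover hdisj)
      (green_symm S hw hcover) (fun ω v => inner_Qps_left S ω v) (deltaP_comp_green S hw hcover)
      (green_comp_deltaP S hw hcover) (qggq_comp_cOp S hw hcover hdisj) f ((mem_gaugeSpace_iff_eq S n).2 hn),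
    B6SectA.deltaPrime_apply_of_mem_ker (lap S) (Qp S) (Qps S) (aOp S w) ((mem_gaugeSpace_iff_eq S n).2 hn)⟩

/-- **(2.26)–(2.27) PROVED for the constructed operators:** with `𝒢 = G′² − G′²Q′*(Q′G′²Q′*)⁻¹Q′G′²` (`B6SectA.calG`)
the (2.17) operator equals `Δ𝒢Δ` (`B6SectA.deltaPrime_calG_deltaPrime`, `conj_calG_eq_lap_calG_lap` with their
inverse hypotheses discharged). [cite: Balaban1984PropagatorsII, (2.26)–(2.27) pp.226–227] -/
theorem eq227 {w : AvgIdx S → ℝ} (hw : ∀ i, 0 < w i) (hcover : Cover S) (hdisj : BlocksOffZero S) :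
    B6SectA.repr217 (green S hw hcover) (Qp S) (Qps S) (cOp S hw hcover hdisj) =
      lap S ∘ₗ B6SectA.calG (green S hw hcover) (Qp S) (Qps S) (cOp S hw hcover hdisj) ∘ₗ lap S := by
  have h1 := B6SectA.conj_calG_eq_lap_calG_lap (lap S) (green S hw hcover) (Qp S) (Qps S) (aOp S w)
    (cOp S hw hcover hdisj) (qggq_comp_cOp S hw hcover hdisj) (cOp_comp_qggq S hw hcover hdisj)
  have h2 := B6SectA.deltaPrime_calG_deltaPrime (deltaP S w) (green S hw hcover) (Qp S) (Qps S)
    (cOp S hw hcover hdisj) (deltaP_comp_green S hw hcover) (green_comp_deltaP S hw hcover)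
  exact h2.symm.trans h1

/-- **(2.26) `R = Δ𝒢Δ`** for the orthogonal projection onto `ΔN(Q′)` and the constructed `𝒢` of (2.27).
[cite: Balaban1984PropagatorsII, (2.26) p.226] -/
theorem eq226 {w : AvgIdx S → ℝ} (hw : ∀ i, 0 < w i) (hcover : Cover S) (hdisj : BlocksOffZero S) :
    ((lapGauge S).starProjection : EuclideanSpace ℝ ι →ₗ[ℝ] EuclideanSpace ℝ ι) =
      lap S ∘ₗ B6SectA.calG (green S hw hcover) (Qp S) (Qps S) (cOp S hw hcover hdisj) ∘ₗ lap S := by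
  rw [eq217_op S hw hcover hdisj, eq227 S hw hcover hdisj]

/-- `Q′𝒢 = 0` and `𝒢Q′* = 0` for the constructed `𝒢` (*"the equalities Q′𝒢 = 𝒢Q′* = 0"*;
`B6SectA.comp_tildeOp_eq_zero` / `tildeOp_comp_eq_zero` discharged). [cite: Balaban1984PropagatorsII, p.227 after (2.27)] -/
theorem calG_annihilate {w : AvgIdx S → ℝ} (hw : ∀ i, 0 < w i) (hcover : Cover S) (hdisj : BlocksOffZero S) :
    Qp S ∘ₗ B6SectA.calG (green S hw hcover) (Qp S) (Qps S) (cOp S hw hcover hdisj) = 0 ∧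
      B6SectA.calG (green S hw hcover) (Qp S) (Qps S) (cOp S hw hcover hdisj) ∘ₗ Qps S = 0 :=
  ⟨B6SectA.comp_tildeOp_eq_zero _ _ _ _ (qggq_comp_cOp S hw hcover hdisj),
    B6SectA.tildeOp_comp_eq_zero _ _ _ _ (cOp_comp_qggq S hw hcover hdisj)⟩

end Main

/-! ## §2. Dictionary: the printed (weighted) adjoint `Q′*_{pr}` and the invariance of (2.17) -/

section Printed

variable (S : BlockSystem ι κ β) [Fintype ι] [Fintype β] [DecidablePred (· ∈ S.zeroSet)]

/-- **The printed adjoint `Q′*_{pr} := Q′* ∘ vol`** of `Q′` for the PRINTED pairings `⟨f,g⟩ = Σ_x η^d f(x)g(x)` on `T_η`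
((2.13)) and `⟨ω, Q′λ⟩ = Σ_jΣ_{y∈Λ_j}(L^jη)^d ω(y)(Q′_jλ)(y)` on 𝔅 ((2.15)); see `pairing215`. [cite: Balaban1984PropagatorsII, (2.15) p.225] -/
def QpsPr : EuclideanSpace ℝ (AvgIdx S) →ₗ[ℝ] EuclideanSpace ℝ ι := Qps S ∘ₗ volOp S

/-- `Q′*_{pr}` IS the adjoint for the printed pairings: `η^d Σ_x (Q′*_{pr}ω)(x)λ(x) = Σ_{y∈Λ₀} η^d ω(y)λ(y) +
Σ_{B^j(y)} (L^jη)^d ω(y)(Q′_jλ)(y)`. [cite: Balaban1984PropagatorsII, (2.15) p.225] -/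
theorem pairing215 (ω : EuclideanSpace ℝ (AvgIdx S)) (f : EuclideanSpace ℝ ι) :
    S.η ^ S.d * ⟪QpsPr S ω, f⟫_ℝ =
      ∑ x : ↥S.zeroSet, S.η ^ S.d * ω (Sum.inl x) * f x +
        ∑ b, (((S.side b : ℝ) + 1) * S.η) ^ S.d * ω (Sum.inr b) * ((vol S b)⁻¹ * ∑ y, f (S.chart b y)) := by
  rw [QpsPr, LinearMap.comp_apply, inner_Qps_left, PiLp.inner_apply, Fintype.sum_sum_type, mul_add,
    Finset.mul_sum, Finset.mul_sum]
  congr 1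
  · refine Finset.sum_congr rfl fun x _ => ?_
    simp only [aOp_apply, Sum.elim_inl, one_mul, Qp_apply_inl, Real.inner_apply]; ring
  · refine Finset.sum_congr rfl fun b _ => ?_
    simp only [aOp_apply, Sum.elim_inr, Qp_apply_inr, Real.inner_apply, mul_pow, vol]; ring

variable [Fintype κ] [DecidableEq κ]

/-- **(2.17) is insensitive to the normalisation of the pairing on 𝔅:** built with the printed adjoint `Q′*_{pr}` and
ITS inverse `vol⁻¹ ∘ (Q′G′²Q′*)⁻¹`, the operator (2.17) is unchanged. [cite: Balaban1984PropagatorsII, (2.17) p.225] -/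
theorem repr217_printedAdjoint {w : AvgIdx S → ℝ} (hw : ∀ i, 0 < w i) (hcover : Cover S)
    (hdisj : BlocksOffZero S) :
    B6SectA.repr217 (green S hw hcover) (Qp S) (QpsPr S) (volInv S ∘ₗ cOp S hw hcover hdisj) =
      B6SectA.repr217 (green S hw hcover) (Qp S) (Qps S) (cOp S hw hcover hdisj) := by
  refine LinearMap.ext fun f => ?_
  have e2 := LinearMap.congr_fun (volOp_comp_volInv S) (cOp S hw hcover hdisj (Qp S (green S hw hcover f)))
  simp only [LinearMap.comp_apply, LinearMap.id_apply] at e2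
  simp only [B6SectA.repr217, QpsPr, LinearMap.sub_apply, LinearMap.id_apply, LinearMap.comp_apply]
  rw [e2]

/-- **(2.17) with the printed adjoint:** `R = I − G′Q′*_{pr}(Q′G′²Q′*_{pr})⁻¹Q′G′`. [cite: Balaban1984PropagatorsII, (2.17) p.225] -/
theorem eq217_printed {w : AvgIdx S → ℝ} (hw : ∀ i, 0 < w i) (hcover : Cover S) (hdisj : BlocksOffZero S)
    (f : EuclideanSpace ℝ ι) :
    (lapGauge S).starProjection f =
      B6SectA.repr217 (green S hw hcover) (Qp S) (QpsPr S) (volInv S ∘ₗ cOp S hw hcover hdisj) f := by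
  rw [repr217_printedAdjoint S hw hcover hdisj]
  exact eq217 S hw hcover hdisj f

end Printed

/-! ## §3. Non-vacuity: r03's explicit 4 × 2 torus block system satisfies `Cover` and `BlocksOffZero` -/

section FourByTwo

open B6Eq211 (fourByTwo Site42)

/-- `Λ₀ = ∅` for `fourByTwo`: membership is decidable. [cite: Balaban1984PropagatorsII, (2.3) p.224] -/
instance decZeroFourByTwo : DecidablePred (· ∈ fourByTwo.zeroSet) := fun _ => Decidable.isFalse fun h => h

/-- (2.4) for `fourByTwo`: the two blocks cover the 4 × 2 torus. [cite: Balaban1984PropagatorsII, (2.4) p.224] -/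
theorem fourByTwo_cover : Cover fourByTwo := by intro x; right; revert x; decide

/-- The blocks of `fourByTwo` avoid `Λ₀ = ∅`. [cite: Balaban1984PropagatorsII, (2.3) p.224] -/
theorem fourByTwo_offZero : BlocksOffZero fourByTwo := fun _ _ h => h

/-- **(2.17) on the 4 × 2 torus with two blocks of side 2** (k = 1, Λ₀ = ∅), any positive weights: an instance of
`eq217` with no hypothesis left. [cite: Balaban1984PropagatorsII, (2.17) p.225] -/
theorem eq217_fourByTwo {w : AvgIdx fourByTwo → ℝ} (hw : ∀ i, 0 < w i) (f : EuclideanSpace ℝ Site42) :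
    (lapGauge fourByTwo).starProjection f =
      B6SectA.repr217 (green fourByTwo hw fourByTwo_cover) (Qp fourByTwo) (Qps fourByTwo)
        (cOp fourByTwo hw fourByTwo_cover fourByTwo_offZero) f :=
  eq217 fourByTwo hw fourByTwo_cover fourByTwo_offZero f

end FourByTwo

end

end Literature.MathematicalPhysics.QuantumFieldTheory.Balaban1983to89.B6Eq217BlockSystem
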